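import Summits.ValiantsHypothesis.ValiantsHypothesis.Theorems.DepthWindowULBReduction
import Summits.ValiantsHypothesis.ValiantsHypothesis.Theorems.DepthWindowExtraction
import Summits.ValiantsHypothesis.ValiantsHypothesis.Theorems.DepthWindowRefresh

/-!
# Route `DepthWindow` — `ULB₂` holds for ALL words: the tree-bias door is CLOSED

Cone-free theorem (decomp-valiant lens 4, g16) supporting the crux item `HomImmHardTwoOne`
(stmt-ValiantsHypothesis-30635).  This file proves the two-level round `TwoLevelRound h` of
`DepthWindowULBReduction` for every `h ≥ 1`, by assembling the extraction level (`exists_extraction`) and the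
refresh level (`exists_refresh_core`) through an ADAPTER turning an idempotent leader map into a surjective
relabelling `Fin n → Fin M` (the format of `lowBiasTree_succ_of_quotient`).  Consequences, now UNCONDITIONAL:

* `universalLowBiasAt_two` — `UniversalLowBiasAt 2`: EVERY integer word `w : Fin d → ℤ` with `|wᵢ| ≤ h`,
  `|Σ w| ≤ h` carries a levelled tree of depth `2·⌊log₂⌊log₂ d⌋⌋ + 3` all of whose node biases are `≤ 64h`;
* `treeBiasDoor_closed` — `¬ TreeBiasGrowthAt (u·2)` for every `u ≥ 1`: no family of words whatsoever feeds the
  A-cell `HomImmHardTwoOne` through `homImmHardAt_two_one_of_treeBiasAt`.  In the language of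
  [LimayeSrinivasanTavenas2022] (Question 1, Thm. 5, Remark 25): `max_W Treebias_Δ(W) ≤ d^{O(2^{-Δ/2})}`, so the
  lopsided relative-rank measure with ANY word is `d^{-ω(1)}`-weak already at product-depth
  `2 log₂ log₂ d + O(1)` — a BARRIER for this method on the depth axis of the chasm, matching the
  [BhargavDuttaSaxena2024] Thm. 1.4 lower bound `d^{≈φ^{-Δ}}` up to the base (`√2` versus `φ`).

References: [LimayeSrinivasanTavenas2022] CCC 2022 (LIPIcs 234:32) Question 1, Thm. 5, §1.2, full version
ECCC TR22-090 Lemma 9, Lemma 21, Algorithm 1, Remark 25; [BhargavDuttaSaxena2024] ACM ToCT 16(4):23 Thm. 1.4,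
Thm. 1.7.
-/

-- layout Summits/ValiantsHypothesis/ValiantsHypothesis forces the duplicated namespace component
set_option linter.dupNamespace false

namespace Summit.ValiantsHypothesis.ValiantsHypothesis.Theorems.DepthWindow.TreeBias

open Finset Literature.Computability.AlgebraicComplexity

variable {n : ℕ}

/-! ### The refresh level, sign-symmetric form -/

/-- **The refresh level**: as `exists_refresh_core`, assuming only that the letters `> e` OR the letters `< −e`
have total modulus `≤ 17h` (apply the core to `z` or to `−z`). [folklore] -/
theorem exists_refresh (z : Fin n → ℤ) {h e : ℕ} (hz : ∀ j, |z j| ≤ h)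
    (hmin : ∑ j ∈ univ.filter (fun j => (e : ℤ) < z j), z j ≤ 17 * h ∨
      -(∑ j ∈ univ.filter (fun j => z j < -(e : ℤ)), z j) ≤ 17 * h) :
    ∃ L : Fin n → Fin n, (∀ i, L (L i) = L i) ∧
      (∀ i, ∑ j ∈ univ.filter (fun j => L j = L i), |z j| ≤ 64 * h) ∧
      (∀ i, |∑ j ∈ univ.filter (fun j => L j = L i), z j| ≤ h) ∧
      ∑ i ∈ univ.filter (fun i => L i = i ∧ (e : ℤ) < |∑ j ∈ univ.filter (fun j => L j = i), z j|),
          |∑ j ∈ univ.filter (fun j => L j = i), z j| ≤ |∑ j, z j| := by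
  classical
  by_cases hc : ∑ j ∈ univ.filter (fun j => (e : ℤ) < z j), z j +
      ∑ j ∈ univ.filter (fun j => z j < -(e : ℤ)), z j ≤ 0
  · refine exists_refresh_core z hz ?_ hc
    rcases hmin with h1 | h1
    · exact h1
    · linarith
  · rw [not_le] at hc
    have hz' : ∀ j, |(-z j)| ≤ h := fun j => by rw [abs_neg]; exact hz j
    have hf1 : univ.filter (fun j => (e : ℤ) < -z j) = univ.filter (fun j => z j < -(e : ℤ)) := by
      ext j; simp only [mem_filter, mem_univ, true_and]; constructor <;> intro h <;> linarith
    have hf2 : univ.filter (fun j => -z j < -(e : ℤ)) = univ.filter (fun j => (e : ℤ) < z j) := by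
      ext j; simp only [mem_filter, mem_univ, true_and]; constructor <;> intro h <;> linarith
    have hQ' : ∑ j ∈ univ.filter (fun j => (e : ℤ) < -z j), -z j ≤ 17 * h := by
      rw [hf1, sum_neg_distrib]
      rcases hmin with h1 | h1
      · linarith
      · exact h1
    have hQQ' : ∑ j ∈ univ.filter (fun j => (e : ℤ) < -z j), -z j +
        ∑ j ∈ univ.filter (fun j => -z j < -(e : ℤ)), -z j ≤ 0 := by
      rw [hf1, hf2, sum_neg_distrib, sum_neg_distrib]; linarith
    obtain ⟨L, hidem, hmass, hval, hhold⟩ := exists_refresh_core (fun j => -z j) hz' hQ' hQQ'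
    refine ⟨L, hidem, fun i => ?_, fun i => ?_, ?_⟩
    · simpa only [abs_neg] using hmass i
    · simpa only [sum_neg_distrib, abs_neg] using hval i
    · simpa only [sum_neg_distrib, abs_neg] using hhold

/-! ### Adapter: leader maps to surjective relabellings -/

/-- **Adapter.**  An idempotent leader map `L` on `Fin n` yields a surjective relabelling `c : Fin n → Fin M`
(`M` = number of leaders) with the same fibres, a system of representatives `rep`, and the re-indexing of sums
over `Fin M` as sums over the leaders. [folklore] -/
theorem exists_quotient_of_leader (L : Fin n → Fin n) (hL : ∀ i, L (L i) = L i) :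
    ∃ (M : ℕ) (c : Fin n → Fin M) (rep : Fin M → Fin n), Function.Surjective c ∧
      (∀ m, L (rep m) = rep m) ∧ (∀ i m, c i = m ↔ L i = rep m) ∧
      ∀ F : Fin n → ℤ, ∑ m, F (rep m) = ∑ a ∈ univ.filter (fun a => L a = a), F a := by
  classical
  set R := univ.filter (fun i => L i = i) with hR
  have hmem : ∀ i, L i ∈ R := fun i => mem_filter.2 ⟨mem_univ _, hL i⟩
  let iso := R.orderIsoOfFin rfl
  let c : Fin n → Fin R.card := fun i => iso.symm ⟨L i, hmem i⟩
  let rep : Fin R.card → Fin n := fun m => (iso m).1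
  have hrep : ∀ m, L (rep m) = rep m := fun m => (mem_filter.1 (iso m).2).2
  have hciff : ∀ i m, c i = m ↔ L i = rep m := by
    intro i m
    show iso.symm ⟨L i, hmem i⟩ = m ↔ L i = (iso m).1
    rw [OrderIso.symm_apply_eq, Subtype.ext_iff]
  refine ⟨R.card, c, rep, fun m => ⟨rep m, (hciff _ _).2 (hrep m)⟩, hrep, hciff, fun F => ?_⟩
  rw [← Finset.sum_coe_sort R F]
  exact Equiv.sum_comp iso.toEquiv (fun a : R => F (a : Fin n))

/-! ### The round -/

/-- Small sums: `ℓ·|t| < 2v` gives `|t| ≤ ⌊(2v−1)/ℓ⌋`. [folklore] -/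
theorem abs_le_div_of_mul_abs_lt {ℓ v : ℕ} (hℓ : 1 ≤ ℓ) {t : ℤ} (ht : (ℓ : ℤ) * |t| < 2 * v) :
    |t| ≤ ((2 * v - 1) / ℓ : ℕ) := by
  have h1 : ℓ * t.natAbs < 2 * v := by
    have : (ℓ : ℤ) * (t.natAbs : ℤ) < 2 * v := by rwa [Int.natCast_natAbs]
    exact_mod_cast this
  have h2 : t.natAbs ≤ (2 * v - 1) / ℓ := by
    rw [Nat.le_div_iff_mul_le (by omega), mul_comm]; omega
  rw [← Int.natCast_natAbs]; exact_mod_cast h2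

/-- **The two-level round, core form**: given the extraction data for `x` with fewer than `ℓ` big POSITIVE
singleton letters left in the pool `U` of letters of modulus `≤ v`, the round's two relabellings exist.
[cite: LimayeSrinivasanTavenas2022, Algorithm 1, Lemma 21] -/
theorem twoLevelRound_core {h : ℕ} (hh : 1 ≤ h) {v : ℕ} (x : Fin n → ℤ) (hv1 : 1 ≤ v) (hvh : v ≤ h)
    (hx : ∀ i, |x i| ≤ h) (hsum : |∑ i, x i| ≤ h) (hhold : holdMass x v ≤ |∑ i, x i|)
    (U : Finset (Fin n)) (hUin : ∀ i ∈ U, |x i| ≤ v) (hUout : ∀ i, i ∉ U → (v : ℤ) < |x i|)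
    (L : Fin n → Fin n) (hidem : ∀ i, L (L i) = L i)
    (hfib : ∀ i, (∀ j, L j = L i ↔ j = i) ∨
      ((∀ j, L j = L i → j ∈ U) ∧
        ((16 * h / v : ℕ) : ℤ) * |∑ j ∈ univ.filter (fun j => L j = L i), x j| < 2 * v ∧
        ∑ j ∈ univ.filter (fun j => L j = L i), |x j| ≤ ((16 * h / v : ℕ) : ℤ) * v))
    (hrest : (U.filter fun i => (∀ j, L j = L i ↔ j = i) ∧
      ¬ (((16 * h / v : ℕ) : ℤ) * |x i| < 2 * v) ∧ 0 < x i).card < 16 * h / v) :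
    ∃ (M₁ : ℕ) (c₁ : Fin n → Fin M₁), Function.Surjective c₁ ∧
      (∀ m, ∑ j ∈ univ.filter (fun j => c₁ j = m), |x j| ≤ 64 * h) ∧
      ∃ (M₂ : ℕ) (c₂ : Fin M₁ → Fin M₂), Function.Surjective c₂ ∧
        (∀ m, ∑ j ∈ univ.filter (fun j => c₂ j = m), |quotWord x c₁ j| ≤ 64 * h) ∧
        (∀ m, |quotWord (quotWord x c₁) c₂ m| ≤ h) ∧
        holdMass (quotWord (quotWord x c₁) c₂) (nxtScale h v) ≤ |∑ i, x i| := by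
  classical
  -- parameters
  obtain ⟨ℓ, hℓ⟩ : ∃ ℓ, ℓ = 16 * h / v := ⟨_, rfl⟩
  obtain ⟨e, he⟩ : ∃ e, e = nxtScale h v := ⟨_, rfl⟩
  rw [← hℓ] at hfib hrest
  rw [← he]
  have hv0 : 0 < v := hv1
  have hℓ16 : 16 ≤ ℓ := by rw [hℓ, Nat.le_div_iff_mul_le hv0]; nlinarith
  have hℓ1 : 1 ≤ ℓ := le_trans (by norm_num) hℓ16
  have hℓv : (ℓ : ℤ) * v ≤ 16 * h := by
    have := Nat.div_mul_le_self (16 * h) v; rw [← hℓ] at this; exact_mod_cast this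
  have hev : e ≤ v := by rw [he]; exact nxtScale_le h v hvh
  have hsmall : ∀ t : ℤ, (ℓ : ℤ) * |t| < 2 * v → |t| ≤ e := by
    intro t ht; rw [he, nxtScale, ← hℓ]; exact abs_le_div_of_mul_abs_lt hℓ1 ht
  have h64 : (h : ℤ) ≤ 64 * h := by have : (0:ℤ) ≤ h := Nat.cast_nonneg h; linarith
  -- level A: the adapter on the extraction leader map
  obtain ⟨M₁, c₁, rep₁, hc₁, hrep₁, hciff₁, hsum₁⟩ := exists_quotient_of_leader L hidem
  have hfibre₁ : ∀ m, univ.filter (fun j => c₁ j = m) = univ.filter (fun j => L j = L (rep₁ m)) := by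
    intro m; ext j; simp only [mem_filter, mem_univ, true_and, hciff₁, hrep₁]
  set z := quotWord x c₁ with hzdef
  have hz_eq : ∀ m, z m = ∑ j ∈ univ.filter (fun j => L j = L (rep₁ m)), x j := by
    intro m; rw [hzdef, quotWord, hfibre₁]
  -- singleton fibres
  have hsing : ∀ i, (∀ j, L j = L i ↔ j = i) → univ.filter (fun j => L j = L i) = {i} := by
    intro i hs; ext j; simp [hs j]
  have hmass₁ : ∀ i, ∑ j ∈ univ.filter (fun j => L j = L i), |x j| ≤ 64 * h := by
    intro i
    rcases hfib i with hs | ⟨_, _, hm⟩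
    · rw [hsing i hs, sum_singleton]; exact (hx i).trans h64
    · calc ∑ j ∈ univ.filter (fun j => L j = L i), |x j| ≤ (ℓ : ℤ) * v := hm
        _ ≤ 64 * h := by linarith
  have hval₁ : ∀ i, |∑ j ∈ univ.filter (fun j => L j = L i), x j| ≤ h := by
    intro i
    rcases hfib i with hs | ⟨_, hsm, _⟩
    · rw [hsing i hs, sum_singleton]; exact hx i
    · exact (hsmall _ hsm).trans (by exact_mod_cast hev.trans hvh)
  have hzh : ∀ m, |z m| ≤ h := fun m => by rw [hz_eq]; exact hval₁ _
  -- the positive letters of `z` above the precision have total ≤ 17h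
  set Rp := U.filter (fun i => (∀ j, L j = L i ↔ j = i) ∧ ¬ ((ℓ : ℤ) * |x i| < 2 * v) ∧ 0 < x i)
    with hRp
  have hpoint : ∀ a, L a = a →
      (if (e : ℤ) < ∑ j ∈ univ.filter (fun j => L j = L a), x j
        then ∑ j ∈ univ.filter (fun j => L j = L a), x j else 0) ≤
      (if (v : ℤ) < |x a| then |x a| else 0) + (if a ∈ Rp then x a else 0) := by
    intro a _
    have h2 : 0 ≤ (if a ∈ Rp then x a else 0) := by
      split_ifs with h
      · exact (mem_filter.1 h).2.2.2.le
      · exact le_rfl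
    have h1 : 0 ≤ (if (v : ℤ) < |x a| then |x a| else 0) := by
      split_ifs
      · exact abs_nonneg _
      · exact le_rfl
    by_cases hst : (e : ℤ) < ∑ j ∈ univ.filter (fun j => L j = L a), x j
    · rw [if_pos hst]
      rcases hfib a with hs | ⟨_, hsm, _⟩
      · rw [hsing a hs, sum_singleton] at hst ⊢
        by_cases haU : a ∈ U
        · have haR : a ∈ Rp := by
            refine mem_filter.2 ⟨haU, hs, fun hlt => ?_, by have : (0:ℤ) ≤ e := Nat.cast_nonneg e; linarith⟩
            have := hsmall _ hlt
            have := le_abs_self (x a); linarith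
          rw [if_pos haR]; linarith
        · rw [if_pos (hUout a haU)]
          have := le_abs_self (x a); linarith
      · exfalso
        have := hsmall _ hsm; have := le_abs_self (∑ j ∈ univ.filter (fun j => L j = L a), x j)
        linarith
    · rw [if_neg hst]; linarith
  have hQp : ∑ m ∈ univ.filter (fun m => (e : ℤ) < z m), z m ≤ 17 * h := by
    rw [sum_filter]
    calc ∑ m, (if (e : ℤ) < z m then z m else 0)
        = ∑ m, (fun a => if (e : ℤ) < ∑ j ∈ univ.filter (fun j => L j = L a), x j
            then ∑ j ∈ univ.filter (fun j => L j = L a), x j else 0) (rep₁ m) :=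
          sum_congr rfl fun m _ => by simp only [hz_eq]
      _ = ∑ a ∈ univ.filter (fun a => L a = a), (if (e : ℤ) < ∑ j ∈ univ.filter (fun j => L j = L a), x j
            then ∑ j ∈ univ.filter (fun j => L j = L a), x j else 0) :=
          hsum₁ (fun a => if (e : ℤ) < ∑ j ∈ univ.filter (fun j => L j = L a), x j
            then ∑ j ∈ univ.filter (fun j => L j = L a), x j else 0)
      _ ≤ ∑ a ∈ univ.filter (fun a => L a = a),
            ((if (v : ℤ) < |x a| then |x a| else 0) + (if a ∈ Rp then x a else 0)) :=
          sum_le_sum fun a ha => hpoint a (mem_filter.1 ha).2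
      _ ≤ ∑ a, ((if (v : ℤ) < |x a| then |x a| else 0) + (if a ∈ Rp then x a else 0)) := by
          refine sum_le_sum_of_subset_of_nonneg (filter_subset _ _) fun a _ _ => add_nonneg ?_ ?_
          · split_ifs
            · exact abs_nonneg _
            · exact le_rfl
          · split_ifs with h
            · exact (mem_filter.1 h).2.2.2.le
            · exact le_rfl
      _ = holdMass x v + ∑ a ∈ Rp, x a := by
          rw [sum_add_distrib, holdMass, sum_filter, sum_ite_mem, univ_inter]
      _ ≤ h + (ℓ : ℤ) * v := by
          refine add_le_add (hhold.trans hsum) ?_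
          calc ∑ a ∈ Rp, x a ≤ ∑ _a ∈ Rp, (v : ℤ) :=
                sum_le_sum fun a ha => (le_abs_self _).trans (hUin a (mem_filter.1 ha).1)
            _ = (Rp.card : ℤ) * v := by rw [sum_const, nsmul_eq_mul]
            _ ≤ (ℓ : ℤ) * v := by
                have : Rp.card ≤ ℓ := hrest.le
                have : (Rp.card : ℤ) ≤ ℓ := by exact_mod_cast this
                have : (0 : ℤ) ≤ v := Nat.cast_nonneg v
                nlinarith
      _ ≤ 17 * h := by linarith
  -- level B
  obtain ⟨L₂, hidem₂, hmass₂, hval₂, hhold₂⟩ := exists_refresh z hzh (e := e) (Or.inl hQp)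
  obtain ⟨M₂, c₂, rep₂, hc₂, hrep₂, hciff₂, hsum₂⟩ := exists_quotient_of_leader L₂ hidem₂
  have hfibre₂ : ∀ m, univ.filter (fun j => c₂ j = m) = univ.filter (fun j => L₂ j = rep₂ m) := by
    intro m; ext j; simp only [mem_filter, mem_univ, true_and, hciff₂]
  have hmass₂' : ∀ a, L₂ a = a → ∑ j ∈ univ.filter (fun j => L₂ j = a), |z j| ≤ 64 * h := by
    intro a ha; have := hmass₂ a; rwa [ha] at this
  have hval₂' : ∀ a, L₂ a = a → |∑ j ∈ univ.filter (fun j => L₂ j = a), z j| ≤ h := by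
    intro a ha; have := hval₂ a; rwa [ha] at this
  set y := quotWord z c₂ with hydef
  have hy_eq : ∀ m, y m = ∑ j ∈ univ.filter (fun j => L₂ j = rep₂ m), z j := by
    intro m; rw [hydef, quotWord, hfibre₂]
  refine ⟨M₁, c₁, hc₁, fun m => by rw [hfibre₁]; exact hmass₁ _, M₂, c₂, hc₂,
    fun m => by rw [hfibre₂]; exact hmass₂' _ (hrep₂ m), fun m => ?_, ?_⟩
  · show |y m| ≤ h
    rw [hy_eq]; exact hval₂' _ (hrep₂ m)
  · show holdMass y e ≤ |∑ i, x i|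
    rw [← sum_quotWord x c₁, ← hzdef]
    refine le_trans (le_of_eq ?_) hhold₂
    rw [holdMass, sum_filter]
    calc ∑ m, (if (e : ℤ) < |y m| then |y m| else 0)
        = ∑ m, (fun a => if (e : ℤ) < |∑ j ∈ univ.filter (fun j => L₂ j = a), z j|
            then |∑ j ∈ univ.filter (fun j => L₂ j = a), z j| else 0) (rep₂ m) :=
          sum_congr rfl fun m _ => by simp only [hy_eq]
      _ = ∑ a ∈ univ.filter (fun a => L₂ a = a),
            (if (e : ℤ) < |∑ j ∈ univ.filter (fun j => L₂ j = a), z j|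
              then |∑ j ∈ univ.filter (fun j => L₂ j = a), z j| else 0) :=
          hsum₂ (fun a => if (e : ℤ) < |∑ j ∈ univ.filter (fun j => L₂ j = a), z j|
              then |∑ j ∈ univ.filter (fun j => L₂ j = a), z j| else 0)
      _ = _ := by rw [← sum_filter, filter_filter]

/-- Negating a word negates its quotient words. [folklore] -/
theorem quotWord_neg (x : Fin n → ℤ) {M : ℕ} (c : Fin n → Fin M) (m : Fin M) :
    quotWord (fun i => -x i) c m = -quotWord x c m := by
  simp [quotWord, sum_neg_distrib]

/-- **The two-level round holds** for every `h ≥ 1`. [cite: LimayeSrinivasanTavenas2022, Algorithm 1,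
Lemma 21] -/
theorem twoLevelRound (h : ℕ) : TwoLevelRound h := by
  classical
  intro n v x hv1 hvh hx hsum hhold
  have hh : 1 ≤ h := le_trans hv1 hvh
  set U := univ.filter (fun i => |x i| ≤ (v : ℤ)) with hU
  have hUin : ∀ i ∈ U, |x i| ≤ v := fun i hi => (mem_filter.1 hi).2
  have hUout : ∀ i, i ∉ U → (v : ℤ) < |x i| := fun i hi => by
    rw [hU, mem_filter, not_and] at hi; exact not_le.1 (hi (mem_univ i))
  have hℓ1 : 1 ≤ 16 * h / v := by
    rw [Nat.le_div_iff_mul_le (by omega)]; nlinarith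
  obtain ⟨L, hidem, _, hfib, hrest⟩ := exists_extraction x (v := v) hℓ1 U hUin
  rcases hrest with hpos | hneg
  · exact twoLevelRound_core hh x hv1 hvh hx hsum hhold U hUin hUout L hidem hfib hpos
  · -- fewer big NEGATIVE singletons: run the core on `-x`
    have hx' : ∀ i, |(-x i)| ≤ h := fun i => by rw [abs_neg]; exact hx i
    have hsum' : |∑ i, -x i| ≤ h := by rw [sum_neg_distrib, abs_neg]; exact hsum
    have hholdneg : ∀ (k : ℕ) (w : Fin k → ℤ) (s : ℕ), holdMass (fun i => -w i) s = holdMass w s := by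
      intro k w s; simp only [holdMass, abs_neg]
    have hhold' : holdMass (fun i => -x i) v ≤ |∑ i, -x i| := by
      rw [hholdneg, sum_neg_distrib, abs_neg]; exact hhold
    have hUin' : ∀ i ∈ U, |(-x i)| ≤ v := fun i hi => by rw [abs_neg]; exact hUin i hi
    have hUout' : ∀ i, i ∉ U → (v : ℤ) < |(-x i)| := fun i hi => by rw [abs_neg]; exact hUout i hi
    have hfib' : ∀ i, (∀ j, L j = L i ↔ j = i) ∨
        ((∀ j, L j = L i → j ∈ U) ∧
          ((16 * h / v : ℕ) : ℤ) * |∑ j ∈ univ.filter (fun j => L j = L i), -x j| < 2 * v ∧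
          ∑ j ∈ univ.filter (fun j => L j = L i), |(-x j)| ≤ ((16 * h / v : ℕ) : ℤ) * v) := by
      intro i
      refine (hfib i).imp id fun h3 => ⟨h3.1, ?_, ?_⟩
      · rw [sum_neg_distrib, abs_neg]; exact h3.2.1
      · simp only [abs_neg]; exact h3.2.2
    have hrest' : (U.filter fun i => (∀ j, L j = L i ↔ j = i) ∧
        ¬ (((16 * h / v : ℕ) : ℤ) * |(-x i)| < 2 * v) ∧ 0 < -x i).card < 16 * h / v := by
      have : (U.filter fun i => (∀ j, L j = L i ↔ j = i) ∧
          ¬ (((16 * h / v : ℕ) : ℤ) * |(-x i)| < 2 * v) ∧ 0 < -x i) =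
          (U.filter fun i => (∀ j, L j = L i ↔ j = i) ∧
          ¬ (((16 * h / v : ℕ) : ℤ) * |x i| < 2 * v) ∧ x i < 0) := by
        refine filter_congr fun i _ => ?_
        rw [abs_neg, neg_pos]
      rw [this]; exact hneg
    obtain ⟨M₁, c₁, hc₁, hm₁, M₂, c₂, hc₂, hm₂, hyh, hyhold⟩ :=
      twoLevelRound_core hh (fun i => -x i) hv1 hvh hx' hsum' hhold' U hUin' hUout' L hidem hfib' hrest'
    have hq₁ : quotWord (fun i => -x i) c₁ = fun m => -quotWord x c₁ m := funext (quotWord_neg x c₁)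
    have hq₂ : quotWord (fun m => -quotWord x c₁ m) c₂ = fun m => -quotWord (quotWord x c₁) c₂ m :=
      funext (quotWord_neg (quotWord x c₁) c₂)
    refine ⟨M₁, c₁, hc₁, fun m => ?_, M₂, c₂, hc₂, fun m => ?_, fun m => ?_, ?_⟩
    · simpa only [abs_neg] using hm₁ m
    · have := hm₂ m; rw [hq₁] at this; simpa only [abs_neg] using this
    · have := hyh m; rw [hq₁, hq₂] at this; simpa only [abs_neg] using this
    · rw [hq₁, hq₂, hholdneg, sum_neg_distrib, abs_neg] at hyhold; exact hyhold

/-! ### `ULB₂` and the closed door, unconditionally -/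

/-- **`ULB₂` holds**: every integer word `w : Fin d → ℤ` with `|wᵢ| ≤ h`, `|Σ w| ≤ h` has a levelled tree of
depth `2·⌊log₂⌊log₂ d⌋⌋ + 3` with all node biases `≤ 64h`.  This answers, for this arity-unbounded levelled
model, the word-optimisation behind [LimayeSrinivasanTavenas2022] Question 1 in the NEGATIVE at product-depth
`2 log₂ log₂ d + O(1)`. [cite: LimayeSrinivasanTavenas2022, Question 1, Thm. 5] -/
theorem universalLowBiasAt_two : UniversalLowBiasAt 2 :=
  universalLowBiasAt_two_of_twoLevelRound fun h _ => twoLevelRound h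

/-- **The tree-bias door is closed**: there is no family of words with tree-bias growth at slope `2u`, for any
`u ≥ 1`; `homImmHardAt_two_one_of_treeBiasAt` can never be fed. [cite: BhargavDuttaSaxena2024, Thm. 1.7] -/
theorem treeBiasDoor_closed {u : ℕ} (hu : 1 ≤ u) : ¬ TreeBiasGrowthAt (u * 2) :=
  treeBiasDoor_closed_of_twoLevelRound (fun h _ => twoLevelRound h) hu

/-- In particular no word family has tree-bias growth at slope `2`. [folklore] -/
theorem not_treeBiasGrowthAt_two : ¬ TreeBiasGrowthAt 2 := by
  simpa using treeBiasDoor_closed (u := 1) le_rfl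

end Summit.ValiantsHypothesis.ValiantsHypothesis.Theorems.DepthWindow.TreeBias
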